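import Summits.AtomisticToContinuum.Crystallization.Theses.HolmgrenBoyleLind

/-!
# Route `HolmgrenBoyleLind`, crux `GroundStatesChargeFLCEquilibrium`: the density-transfer step

Support file for item stmt-AtomisticToContinuum-6076 (crux
`HolmgrenBoyleLind.GroundStatesChargeFLCEquilibrium`), stub `stub_lawChargingTransfers` of the
registered line: the portmanteau / density-transfer step. Let `x` be finite configurations, `φ` a
subsequence and `P` a probability law on counting measures `ν` of `ℝ³`, tied to `x ∘ φ` by the
density-transfer clause of the Benjamini–Schramm limit of ground states (verbatim). If `P` charges at
every scale `(R, ε)` the two-way matching event of the atoms of `ν` with the rotated patch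
`A (Λ − q)`, then for all `R, ε > 0` there is `ρ > 0` such that, eventually in `j`, at least `ρ·φ(j)`
particles `i` of `x^(φ j)` have their `R`-neighbourhood two-way `ε`-matched with `x_i + A (Λ − q)`.

Proof: `T :=` the law-level event with radius `R + ε/2` and tolerance `ε/2` (`P T ≠ 0`),
`ρ := P(T)/2 < P(T)`; the transfer clause with these parameters counts particles whose recentred
configuration is two-way `(ε/2)`-matched on the ball of radius `R + ε/2` with the atoms of some
`ν ∈ T`, and the two matchings compose (`lawCharging_matched_of_matched_event`, two triangle
inequalities and `‖A v‖ = ‖v‖`); monotonicity of `Nat.card` under a pointwise implication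
(`Nat.card_le_card_of_injective` on `Subtype.map id`) finishes.

All `[folklore]`; nothing here closes an item.
-/

noncomputable section

namespace Summit.AtomisticToContinuum.Crystallization.Theorems.HolmgrenBoyleLindGroundStatesChargeFLCEquilibrium

open MeasureTheory Filter
open scoped ENNReal Topology
open Literature.MathematicalPhysics.StatisticalMechanics

-- adapted from Cruxes/GroundStatesChargePeriodic/Pieces.lean (`matched_periodic_of_matched_event`,
-- with the periodic point set `Q.points` replaced by an arbitrary set `Λ`)
/-- **From a matched charged configuration to a matched patch.** If the configuration `ν` is
two-way `(ε/2)`-matched on the ball of radius `R + ε/2` with the rotated, re-based point set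
`A (Λ - q)`, and the recentred finite configuration `{x k - x i}` is two-way `(ε/2)`-matched on the
ball of radius `R + ε/2` with the atoms of `ν`, then the `R`-neighbourhood of particle `i` is
two-way `ε`-matched with `x i + A (Λ - q)`. [folklore] -/
theorem lawCharging_matched_of_matched_event {N : ℕ} (x : Fin N → EuclideanSpace ℝ (Fin 3))
    (i : Fin N) (Λ : Set (EuclideanSpace ℝ (Fin 3))) {R ε : ℝ} (hε : 0 ≤ ε)
    (ν : Measure (EuclideanSpace ℝ (Fin 3)))
    (A : EuclideanSpace ℝ (Fin 3) →ₗᵢ[ℝ] EuclideanSpace ℝ (Fin 3))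
    {q : EuclideanSpace ℝ (Fin 3)}
    (hQ1 : ∀ s ∈ Λ, dist s q ≤ R + ε / 2 →
      ∃ y : EuclideanSpace ℝ (Fin 3), ν {y} ≠ 0 ∧ dist y (A (s - q)) ≤ ε / 2)
    (hQ2 : ∀ y : EuclideanSpace ℝ (Fin 3), ν {y} ≠ 0 → ‖y‖ ≤ R + ε / 2 →
      ∃ s ∈ Λ, dist y (A (s - q)) ≤ ε / 2)
    (h1 : ∀ p : EuclideanSpace ℝ (Fin 3), ν {p} ≠ 0 → ‖p‖ ≤ R + ε / 2 →
      ∃ q' ∈ Set.range (fun k : Fin N => x k - x i), dist q' p ≤ ε / 2)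
    (h2 : ∀ q' ∈ Set.range (fun k : Fin N => x k - x i), ‖q'‖ ≤ R + ε / 2 →
      ∃ p : EuclideanSpace ℝ (Fin 3), ν {p} ≠ 0 ∧ dist q' p ≤ ε / 2) :
    (∀ s ∈ Λ, dist s q ≤ R → ∃ j : Fin N, dist (x j) (x i + A (s - q)) ≤ ε) ∧
      (∀ j : Fin N, dist (x j) (x i) ≤ R → ∃ s ∈ Λ, dist (x j) (x i + A (s - q)) ≤ ε) := by
  have hkey : ∀ (j : Fin N) (s : EuclideanSpace ℝ (Fin 3)),
      dist (x j) (x i + A (s - q)) = dist (x j - x i) (A (s - q)) := by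
    intro j s
    rw [dist_eq_norm, dist_eq_norm, sub_add_eq_sub_sub]
  have hnA : ∀ s : EuclideanSpace ℝ (Fin 3), ‖A (s - q)‖ = dist s q := by
    intro s
    rw [LinearIsometry.norm_map, dist_eq_norm]
  constructor
  · intro s hs hsR
    obtain ⟨y, hy, hyd⟩ := hQ1 s hs (by linarith)
    have hyn : ‖y‖ ≤ R + ε / 2 := by
      calc ‖y‖ = dist y 0 := (dist_zero_right _).symm
        _ ≤ dist y (A (s - q)) + dist (A (s - q)) 0 := dist_triangle _ _ _
        _ ≤ ε / 2 + R := by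
            rw [dist_zero_right, hnA]; exact add_le_add hyd hsR
        _ = R + ε / 2 := by ring
    obtain ⟨q', ⟨k, rfl⟩, hk⟩ := h1 y hy hyn
    refine ⟨k, ?_⟩
    rw [hkey]
    calc dist (x k - x i) (A (s - q)) ≤ dist (x k - x i) y + dist y (A (s - q)) :=
          dist_triangle _ _ _
      _ ≤ ε / 2 + ε / 2 := add_le_add hk hyd
      _ = ε := by ring
  · intro j hj
    have hq' : x j - x i ∈ Set.range (fun k : Fin N => x k - x i) := ⟨j, rfl⟩
    have hq'n : ‖x j - x i‖ ≤ R + ε / 2 := by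
      rw [← dist_eq_norm]; linarith
    obtain ⟨p, hp, hpd⟩ := h2 _ hq' hq'n
    have hpn : ‖p‖ ≤ R + ε / 2 := by
      calc ‖p‖ = dist p 0 := (dist_zero_right _).symm
        _ ≤ dist p (x j - x i) + dist (x j - x i) 0 := dist_triangle _ _ _
        _ ≤ ε / 2 + R := by
            rw [dist_zero_right, dist_comm, ← dist_eq_norm]; exact add_le_add hpd hj
        _ = R + ε / 2 := by ring
    obtain ⟨s, hs, hsd⟩ := hQ2 p hp hpn
    refine ⟨s, hs, ?_⟩
    rw [hkey]
    calc dist (x j - x i) (A (s - q)) ≤ dist (x j - x i) p + dist p (A (s - q)) :=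
          dist_triangle _ _ _
      _ ≤ ε / 2 + ε / 2 := add_le_add hpd hsd
      _ = ε := by ring

/-- **Density transfer (portmanteau ⇒ charging), stub `stub_lawChargingTransfers` of the line for
the crux `GroundStatesChargeFLCEquilibrium`.** Let `x` be configurations, `φ` a subsequence and `P` a
probability law tied to `x ∘ φ` by the density-transfer clause of the Benjamini–Schramm limit
(item 9230, verbatim). If `P` charges at every scale `(R, ε)` the patch of `Λ` at the base point `q`
(law-level two-way matching event of positive mass), then for all `R, ε > 0` there is `ρ > 0` such
that, eventually in `j`, at least `ρ·φ(j)` particles `i` of `x^(φ j)` have their `R`-neighbourhood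
two-way `ε`-matched with `x_i + A (Λ − q)` for some linear isometry `A`. Proof: `T :=` the law-level
event with radius `R + ε/2` and tolerance `ε/2`; `P T ≠ 0` gives `ρ := P(T)/2 < P(T)`; the transfer
clause with radius `R + ε/2`, tolerance `ε/2` yields particles whose recentred configuration is
matched to some `ν ∈ T`, and the two two-way matchings compose
(`lawCharging_matched_of_matched_event`). [folklore] -/
theorem stub_lawChargingTransfers :
    ∀ (x : (N : ℕ) → (Fin N → EuclideanSpace ℝ (Fin 3))) (φ : ℕ → ℕ)
      (P : Measure (Measure (EuclideanSpace ℝ (Fin 3)))), IsProbabilityMeasure P →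
      (∀ T : Set (Measure (EuclideanSpace ℝ (Fin 3))), ∀ R ε : ℝ, 0 < ε → ∀ ρ : ℝ,
        ρ < (P T).toReal → ∀ᶠ j : ℕ in Filter.atTop, ρ * (φ j : ℝ) ≤
          (Nat.card {i : Fin (φ j) // ∃ ν ∈ T,
            ((∀ p : EuclideanSpace ℝ (Fin 3), ν {p} ≠ 0 → ‖p‖ ≤ R →
                ∃ q ∈ (Set.range (fun k : Fin (φ j) => x (φ j) k - x (φ j) i)), dist q p ≤ ε) ∧
              (∀ q ∈ (Set.range (fun k : Fin (φ j) => x (φ j) k - x (φ j) i)), ‖q‖ ≤ R →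
                ∃ p : EuclideanSpace ℝ (Fin 3), ν {p} ≠ 0 ∧ dist q p ≤ ε))} : ℝ)) →
      ∀ (Λ : Set (EuclideanSpace ℝ (Fin 3))) (q : EuclideanSpace ℝ (Fin 3)),
        (∀ R ε : ℝ, 0 < R → 0 < ε →
          P {ν : Measure (EuclideanSpace ℝ (Fin 3)) |
              ∃ A : EuclideanSpace ℝ (Fin 3) →ₗᵢ[ℝ] EuclideanSpace ℝ (Fin 3),
                (∀ s ∈ Λ, dist s q ≤ R →
                  ∃ p : EuclideanSpace ℝ (Fin 3), ν {p} ≠ 0 ∧ dist p (A (s - q)) ≤ ε) ∧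
                (∀ p : EuclideanSpace ℝ (Fin 3), ν {p} ≠ 0 → ‖p‖ ≤ R →
                  ∃ s ∈ Λ, dist p (A (s - q)) ≤ ε)} ≠ 0) →
        ∀ R ε : ℝ, 0 < R → 0 < ε → ∃ ρ : ℝ, 0 < ρ ∧ ∀ᶠ j : ℕ in Filter.atTop,
          ρ * (φ j : ℝ) ≤ (Nat.card {i : Fin (φ j) //
            ∃ A : EuclideanSpace ℝ (Fin 3) →ₗᵢ[ℝ] EuclideanSpace ℝ (Fin 3),
              (∀ s ∈ Λ, dist s q ≤ R →
                ∃ k : Fin (φ j), dist (x (φ j) k) (x (φ j) i + A (s - q)) ≤ ε) ∧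
              (∀ k : Fin (φ j), dist (x (φ j) k) (x (φ j) i) ≤ R →
                ∃ s ∈ Λ, dist (x (φ j) k) (x (φ j) i + A (s - q)) ≤ ε)} : ℝ) := by
  intro x φ P _hP htr Λ q hch R ε hR hε
  -- the matching event at radius `R + ε/2`, tolerance `ε/2`
  set T : Set (Measure (EuclideanSpace ℝ (Fin 3))) :=
    {ν | ∃ A : EuclideanSpace ℝ (Fin 3) →ₗᵢ[ℝ] EuclideanSpace ℝ (Fin 3),
      (∀ s ∈ Λ, dist s q ≤ R + ε / 2 →
        ∃ p : EuclideanSpace ℝ (Fin 3), ν {p} ≠ 0 ∧ dist p (A (s - q)) ≤ ε / 2) ∧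
      (∀ p : EuclideanSpace ℝ (Fin 3), ν {p} ≠ 0 → ‖p‖ ≤ R + ε / 2 →
        ∃ s ∈ Λ, dist p (A (s - q)) ≤ ε / 2)} with hTdef
  have hT : P T ≠ 0 := hch (R + ε / 2) (ε / 2) (by positivity) (half_pos hε)
  have hTreal : 0 < (P T).toReal := ENNReal.toReal_pos hT (measure_ne_top P T)
  refine ⟨(P T).toReal / 2, half_pos hTreal, ?_⟩
  have hev := htr T (R + ε / 2) (ε / 2) (half_pos hε) ((P T).toReal / 2) (half_lt_self hTreal)
  -- the property transferred to `N = φ j`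
  have himp : ∀ (N : ℕ) (i : Fin N),
      (∃ ν ∈ T, ((∀ p : EuclideanSpace ℝ (Fin 3), ν {p} ≠ 0 → ‖p‖ ≤ R + ε / 2 →
          ∃ q' ∈ (Set.range (fun k : Fin N => x N k - x N i)), dist q' p ≤ ε / 2) ∧
        (∀ q' ∈ (Set.range (fun k : Fin N => x N k - x N i)), ‖q'‖ ≤ R + ε / 2 →
          ∃ p : EuclideanSpace ℝ (Fin 3), ν {p} ≠ 0 ∧ dist q' p ≤ ε / 2))) →
      ∃ A : EuclideanSpace ℝ (Fin 3) →ₗᵢ[ℝ] EuclideanSpace ℝ (Fin 3),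
        (∀ s ∈ Λ, dist s q ≤ R → ∃ k : Fin N, dist (x N k) (x N i + A (s - q)) ≤ ε) ∧
        (∀ k : Fin N, dist (x N k) (x N i) ≤ R →
          ∃ s ∈ Λ, dist (x N k) (x N i + A (s - q)) ≤ ε) := by
    rintro N i ⟨ν, ⟨A, hQ1, hQ2⟩, h1, h2⟩
    exact ⟨A, lawCharging_matched_of_matched_event (x N) i Λ hε.le ν A hQ1 hQ2 h1 h2⟩
  -- monotonicity of the count under the pointwise implication `himp`
  have hmono : ∀ {α : Type} [Finite α] {p₁ p₂ : α → Prop}, (∀ a, p₁ a → p₂ a) →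
      Nat.card {a // p₁ a} ≤ Nat.card {a // p₂ a} := fun h =>
    Nat.card_le_card_of_injective (Subtype.map id h) (Subtype.map_injective h Function.injective_id)
  filter_upwards [hev] with j hj
  refine hj.trans ?_
  exact_mod_cast hmono (himp (φ j))

end Summit.AtomisticToContinuum.Crystallization.Theorems.HolmgrenBoyleLindGroundStatesChargeFLCEquilibrium

end
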